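import Summits.QuantumAdvantage.QuantumAdvantage.Theorems.CubicForrelationSignedExactCubicForrelationNotPrBPPStubCubeBlockSumsConfine
import Summits.QuantumAdvantage.QuantumAdvantage.Theorems.CubicForrelationSignedExactCubicForrelationNotPrBPPStubCubeBlockSumsEvent
import Summits.QuantumAdvantage.QuantumAdvantage.Theorems.CubicForrelationSignedExactCubicForrelationNotPrBPPStubNoTrapTransport
import Summits.QuantumAdvantage.QuantumAdvantage.Theorems.CubicForrelationSignedExactCubicForrelationNotPrBPPStubCoreReductionTransport

/-!
# Crux `CubicForrelation.SignedExactCubicForrelationNotPrBPP` (stmt-QuantumAdvantage-13932), line `dual-pingpong-frame`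
# (classify-then-count cut): stub `stub_cubeBlockSums` (H4) — KERNEL STATISTICS OF CUBE-ORBIT INSTANCES AT EVERY
# CLOSED ORTHOGONAL PROPER PAIR

File 4/4: the registered stub `stub_cubeBlockSums` of the skeleton `Lines/classify_then_count.lean`, verbatim. For an
exact cubic pair `(a, b) = ((C 0).eval, (C 1).eval)` on `6k` bits whose `b` carries a CUBE-ORBIT DATUM — an affine
bijection `e` with `b(e(y', y'')) = y'·cube^k(y'') ⊕ h(y'') ⊕ ℓ·y'` — and EVERY pair `(S, U)` of subspaces that is
closed for `b`, closed for `a`, orthogonal and proper, the `b`-side kernel statistic holds: for `r = ⌊log₂ k⌋ + 2 ≤ 6k + 1`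
uniform probes the good mass is `≥ 2^(6k r)/(6k+2)⁸`. (Radical absorption, `|U| < 2^(3k)` and `IsOverB2` are not used.)

Proof. ORBIT TRANSPORT as in the landed `stub_noTrapTransport` / `coreReduction_zero`: with `e y = L y ⊕ c_b`,
`b₀ = b ∘ e` is the template `y'·π(y'') ⊕ h(y'')` over the permutation `π = permL k ℓ = cube^k ⊕ ℓ`
(`template_bool_lin`: the linear term is absorbed into the permutation), `Φ(a₀, b₀) = Φ(a, b) = ±1` for
`a₀ = a ∘ L⁻ᵀ ⊕ (L⁻ᵀ·)·c_b` (`forrelation_transport`), so `a₀` is the dual template (`stub_dualShape`); the pair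
`(L⁻¹ S, Lᵀ U)` is closed for `b₀` and `a₀` (`closedF_transport`), orthogonal and proper; the template theorem
`CubeBS.cubeBlockSums_template` (frame confinement `S ⊆ Y' × 0`, `U ⊆ 0 × X''` by block nondegeneracy of the cube,
then W1's event at a block not swallowed by `S`) bounds the good mass of `b₀`, and `goodMass_transport` carries the
bound back to `b` at `(S, U)`.

References: C. Carlet, *Boolean Functions for Cryptography and Coding Theory*, CUP 2021, §2.2.2, Prop. 54, Prop. 77
[Carlet2020]; S. Aaronson, A. Ambainis, Forrelation, SIAM J. Comput. 47 (2018), §1.1.1 [AaronsonAmbainis2018];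
K. Nyberg, EUROCRYPT '93 [Nyberg1994]. -/

noncomputable section

set_option linter.dupNamespace false -- D-0017: single-problem summit ⇒ `QuantumAdvantage.QuantumAdvantage` by design

namespace Summit.QuantumAdvantage.QuantumAdvantage.Theorems.SignedExactCubicForrelationNotPrBPP

open Finset
open Literature.Computability.Complexity Literature.Computability.QuantumComplexity
open Literature.Computability.QuantumComplexity.BuzetChailloux (bxor zeroVec bxor_self bxor_comm bxor_zeroVec
  zeroVec_bxor)
open Literature.Computability.Complexity.BLR (toZ toZ_xor toZ_and toZ_injective)
open PolarGeometry (toZ_bdot bdot_comm bdot_bxor_left bdot_bxor_right bxor_append exists_append)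
open Summit.QuantumAdvantage.QuantumAdvantage.Theorems.SignedCubicForrelationNotPrBPP (knf_isDegLeFun_xor')
open Summit.QuantumAdvantage.QuantumAdvantage.Theorems.CubicForrelation.NearExactIsExact (ur_bxor_cancel_right)
open Covariance
open CubeKS (rK_le)

namespace CubeBS

/-! ### The template theorem (frame confinement + the statistic at a confined pair) -/

/-- **KERNEL STATISTICS OF THE CUBE TEMPLATE AT A CLOSED ORTHOGONAL PROPER PAIR** (template form of stub
`stub_cubeBlockSums`). For the cubic template pair `b = y'·(cube^k(y'') ⊕ ℓ) ⊕ h(y'')`,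
`a = x''·σ(x') ⊕ h(σ x') ⊕ c` and a pair `(S, U)` closed for `b`, closed for `a`, orthogonal, with `S ∋ 0` `⊕`-closed
and `|S| < 2^(3k)`: `goodMass_b(S, U, r) ≥ 2^(6k r)/(6k+2)⁸` for `r = ⌊log₂ k⌋ + 2 ≤ 6k + 1`. Frame confinement puts
`S` inside the frame `Y' × 0` and `U` inside `0 × X''`; a block `q₀` not swallowed by `S` carries W1's event.
[cite: Carlet2020, Prop. 54] -/
theorem cubeBlockSums_template (k : ℕ) (hk : 0 < k) (ℓ : Fin (k * 3) → Bool)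
    (a b : (Fin (k * 3 + k * 3) → Bool) → Bool) (h : (Fin (k * 3) → Bool) → Bool) (c : Bool)
    (ha3 : IsDegLeFun 3 a) (hb3 : IsDegLeFun 3 b)
    (hbt : ∀ y' y'' : Fin (k * 3) → Bool, b (Fin.append y' y'') =
      (((Finset.univ.filter fun i => y' i && (permL k ℓ y'') i).card.bodd) ^^ h y''))
    (hat : ∀ x' x'' : Fin (k * 3) → Bool, a (Fin.append x' x'') =
      (((Finset.univ.filter fun i => x'' i && ((permL k ℓ).symm x') i).card.bodd) ^^ h ((permL k ℓ).symm x') ^^ c))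
    (S U : Finset (Fin (k * 3 + k * 3) → Bool))
    (hS : zeroVec ∈ S ∧ ∀ x ∈ S, ∀ y ∈ S, bxor x y ∈ S)
    (hcb : (∀ s ∈ S, ∀ y : Fin (k * 3 + k * 3) → Bool, (fun k => (b zeroVec ^^ b (bxor zeroVec s) ^^ b (bxor zeroVec y) ^^ b (bxor zeroVec (bxor s y))) ^^ (b (fun j => decide (j = k)) ^^ b (bxor (fun j => decide (j = k)) s) ^^ b (bxor (fun j => decide (j = k)) y) ^^ b (bxor (fun j => decide (j = k)) (bxor s y)))) ∈ U) ∧ (∀ s ∈ S, ∃ ℓ ∈ U, ∀ r : Fin (k * 3 + k * 3) → Bool, (∀ y z : Fin (k * 3 + k * 3) → Bool, ((b z ^^ b (bxor z s) ^^ b (bxor z r) ^^ b (bxor z (bxor s r))) ^^ (b (bxor z y) ^^ b (bxor (bxor z y) s) ^^ b (bxor (bxor z y) r) ^^ b (bxor (bxor z y) (bxor s r)))) = false) → (b r ^^ b (bxor r s) ^^ b zeroVec ^^ b s) = ((Finset.univ.filter fun i => ℓ i && r i).card).bodd))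
    (hca : (∀ s ∈ U, ∀ y : Fin (k * 3 + k * 3) → Bool, (fun k => (a zeroVec ^^ a (bxor zeroVec s) ^^ a (bxor zeroVec y) ^^ a (bxor zeroVec (bxor s y))) ^^ (a (fun j => decide (j = k)) ^^ a (bxor (fun j => decide (j = k)) s) ^^ a (bxor (fun j => decide (j = k)) y) ^^ a (bxor (fun j => decide (j = k)) (bxor s y)))) ∈ S) ∧ (∀ s ∈ U, ∃ ℓ ∈ S, ∀ r : Fin (k * 3 + k * 3) → Bool, (∀ y z : Fin (k * 3 + k * 3) → Bool, ((a z ^^ a (bxor z s) ^^ a (bxor z r) ^^ a (bxor z (bxor s r))) ^^ (a (bxor z y) ^^ a (bxor (bxor z y) s) ^^ a (bxor (bxor z y) r) ^^ a (bxor (bxor z y) (bxor s r)))) = false) → (a r ^^ a (bxor r s) ^^ a zeroVec ^^ a s) = ((Finset.univ.filter fun i => ℓ i && r i).card).bodd))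
    (ho : ∀ s ∈ S, ∀ u ∈ U, ((Finset.univ.filter fun i => s i && u i).card).bodd = false)
    (hSlt : S.card < 2 ^ (k * 3)) :
    ∃ r : ℕ, r ≤ k * 3 + k * 3 + 1 ∧ (2 : ℝ) ^ ((k * 3 + k * 3) * r) / ((k * 3 + k * 3 + 2 : ℝ) ^ 8) ≤ (∑ xs : Fin (r) → (Fin (k * 3 + k * 3) → Bool), (((@Finset.filter (Fin (k * 3 + k * 3) → Bool) (fun v => v ∉ S ∧ (∃ V : Finset (Fin (k * 3 + k * 3) → Bool), ((zeroVec ∈ V ∧ ∀ x ∈ V, ∀ y ∈ V, bxor x y ∈ V) ∧ (((V).card : ℝ) ^ 2 = (2 : ℝ) ^ (k * 3 + k * 3)) ∧ ∀ u ∈ V, ∀ v ∈ V, ∀ x, (b x ^^ b (bxor x u) ^^ b (bxor x v) ^^ b (bxor x (bxor u v))) = false) ∧ S ⊆ V ∧ v ∈ V ∧ (∀ s ∈ V, ∀ u ∈ U, ((Finset.univ.filter fun i => s i && u i).card).bodd = false))) (Classical.decPred _) (Finset.univ.filter fun (v : Fin (k * 3 + k * 3) → Bool) => (∀ s ∈ S,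 ∀ x, (b x ^^ b (bxor x s) ^^ b (bxor x v) ^^ b (bxor x (bxor s v))) = false) ∧ (∀ u ∈ U, ((Finset.univ.filter fun i => u i && v i).card).bodd = false) ∧ ∀ j, (∀ y z : Fin (k * 3 + k * 3) → Bool, ((b z ^^ b (bxor z (xs j)) ^^ b (bxor z v) ^^ b (bxor z (bxor (xs j) v))) ^^ (b (bxor z y) ^^ b (bxor (bxor z y) (xs j)) ^^ b (bxor (bxor z y) v) ^^ b (bxor (bxor z y) (bxor (xs j) v)))) = false))).card : ℝ) / (((Finset.univ.filter fun (v : Fin (k * 3 + k * 3) → Bool) => (∀ s ∈ S, ∀ x, (b x ^^ b (bxor x s) ^^ b (bxor x v) ^^ b (bxor x (bxor s v))) = false) ∧ (∀ u ∈ U, ((Finset.univ.filter fun i => u i && v i).card).bodd = false) ∧ ∀ j, (∀ y z : Fin (k * 3 + k * 3) → Bool, ((b z ^^ b (bxor z (xs j)) ^^ b (bxor z v) ^^ b (bxor z (bxor (xs j) v))) ^^ (b (bxor z y) ^^ b (bxor (bxor z y) (xs j)) ^^ b (bxor (bxor z y) v) ^^ b (bxor (bxor z y) (bxor (xs j) v))))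 = false))).card : ℝ))) := by
  have hπ2 : ∀ i, IsDegLeFun 2 fun y => permL k ℓ y i := Covariance.isDegLeFun_two_perm hb3 hbt
  have hσ2 : ∀ i, IsDegLeFun 2 fun x => (permL k ℓ).symm x i := Covariance.isDegLeFun_two_symm ha3 hat
  obtain ⟨hSfr, hUfr⟩ := frame_confine a b (permL k ℓ) h c hπ2 hσ2 ha3 hb3 hbt hat
    (fun t ht => nd1 ℓ t ht) (fun u hu => nd2 ℓ u hu) S U hcb hca ho
  obtain ⟨q₀, a₀, ha₀⟩ := exists_block_notin hS.1 hS.2 hSlt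
  exact ⟨Nat.log 2 k + 2, rK_le k hk, sum_bound_SU k hk ℓ h b hbt S U hSfr hUfr q₀ a₀ ha₀⟩

end CubeBS

/-- **The `ZMod 2` cube-orbit identity is a Boolean template over `permL`**: `[g(y', y'')] = ∑ᵢ [y'ᵢ][cube^k(y'')ᵢ] +
[h y''] + ∑ᵢ [y'ᵢ][ℓᵢ]` over `ZMod 2` says `g(y', y'') = y'·(cube^k(y'') ⊕ ℓ) ⊕ h(y'')` with the inner product bit —
the linear term `ℓ·y'` is absorbed into the permutation `permL k ℓ = cube^k ⊕ ℓ`. [cite: Carlet2020, Prop. 54] -/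
theorem CubeBS.template_bool_lin {k : ℕ} {g : (Fin (k * 3 + k * 3) → Bool) → Bool} {h : (Fin (k * 3) → Bool) → Bool}
    {ℓ : Fin (k * 3) → Bool}
    (hg : ∀ y' y'' : Fin (k * 3) → Bool, (if g (Fin.append y' y'') then (1 : ZMod 2) else 0) =
      (∑ i, (if y' i then (1 : ZMod 2) else 0) * (if (fun x : Fin 3 → Bool => (![x 0 ^^ x 1 ^^ x 2 ^^ (x 1 && x 2), (x 0 && x 1) ^^ (x 0 && x 2) ^^ x 1, (x 0 && x 1) ^^ x 2] : Fin 3 → Bool)) (fun s => y'' (finProdFinEquiv ((finProdFinEquiv.symm i).1, s))) (finProdFinEquiv.symm i).2 then (1 : ZMod 2) else 0)) +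
        (if h y'' then (1 : ZMod 2) else 0) + (∑ i, (if y' i then (1 : ZMod 2) else 0) * (if ℓ i then (1 : ZMod 2) else 0))) :
    ∀ y' y'' : Fin (k * 3) → Bool, g (Fin.append y' y'') =
      ((Finset.univ.filter fun i => y' i && (CubeBS.permL k ℓ y'') i).card.bodd ^^ h y'') := by
  intro y' y''
  apply toZ_injective
  have key := hg y' y''
  change toZ (g (Fin.append y' y'')) =
    (∑ i, toZ (y' i) * toZ (CubeKS.cubeP k y'' i)) + toZ (h y'') + ∑ i, toZ (y' i) * toZ (ℓ i) at key
  have e : ∀ i, toZ (y' i && (CubeBS.permL k ℓ y'') i) =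
      toZ (y' i) * toZ (CubeKS.cubeP k y'' i) + toZ (y' i) * toZ (ℓ i) := by
    intro i
    show toZ (y' i && (CubeKS.cubeP k y'' i ^^ ℓ i)) = _
    rw [toZ_and, toZ_xor, mul_add]
  rw [key, toZ_xor, toZ_bdot]
  simp only [e]
  rw [Finset.sum_add_distrib]
  ring

/-- **A proper subspace of `𝔽₂^(6k)` misses the frame** (registered handle `cubeBlockSums_frameProper` of stub
`stub_cubeBlockSums`; the stub itself exceeds the registry's signature length bound): if `0 ∈ S`, `S` is `⊕`-closed
and `|S| < 2^(3k)` then some vector with vanishing second half lies outside `S` — the block `q₀` carrying the good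
frame vectors of the kernel statistics. [folklore] -/
theorem cubeBlockSums_frameProper : ∀ {k : ℕ} (S : Finset (Fin (k * 3 + k * 3) → Bool)), zeroVec ∈ S → (∀ x ∈ S, ∀ y ∈ S, bxor x y ∈ S) → S.card < 2 ^ (k * 3) → ∃ v : Fin (k * 3 + k * 3) → Bool, v ∉ S ∧ (fun j => v (Fin.natAdd (k * 3) j)) = zeroVec := by
  intro k S h0 hadd hlt
  obtain ⟨q, a, hqa⟩ := CubeBS.exists_block_notin h0 hadd hlt
  exact ⟨_, hqa, funext fun j => Fin.append_right _ _ j⟩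

set_option maxHeartbeats 4000000 in
/-- **stub `stub_cubeBlockSums` (registered, H4; line `dual-pingpong-frame`, classify-then-count cut): KERNEL STATISTICS
OF CUBE-ORBIT INSTANCES AT EVERY CLOSED ORTHOGONAL PROPER PAIR.** For an exact cubic pair on `6k` bits whose `b` has a
cube-orbit datum (`b ∘ e = y'·cube^k(y'') ⊕ h(y'') ⊕ ℓ·y'`, `e` affine) and every closed orthogonal proper pair
`(S, U)`, the `b`-side disjunct of the live line's core statement holds with `r = ⌊log₂ k⌋ + 2`. Orbit transport to the template
(`template_bool_lin`, `forrelation_transport`, `stub_dualShape`, `closedF_transport`), the template theorem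
`CubeBS.cubeBlockSums_template` (frame confinement + W1's event at a free block), and `goodMass_transport` back.
[cite: Carlet2020, Prop. 54] [cite: AaronsonAmbainis2018, §1.1.1] -/
theorem stub_cubeBlockSums :
    ∀ (k : ℕ), 0 < k → ∀ (C : Fin 2 → Circuit (Fin (k * 3 + k * 3))),
        (⟨k * 3 + k * 3, 2, C⟩ : KForrelationInstance).IsOverB2 →
        (∀ i, IsDegLeFun 3 (C i).eval) →
        (forrelation (C 0).eval (C 1).eval = 1 ∨ forrelation (C 0).eval (C 1).eval = -1) →
        (∃ e : (Fin (k * 3 + k * 3) → Bool) ≃ (Fin (k * 3 + k * 3) → Bool),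
          (∃ M : Matrix (Fin (k * 3 + k * 3)) (Fin (k * 3 + k * 3)) (ZMod 2), ∃ c : Fin (k * 3 + k * 3) → ZMod 2,
            ∀ y i, (if e y i then (1 : ZMod 2) else 0) = (M.mulVec (fun j => if y j then (1 : ZMod 2) else 0) + c) i) ∧
          ∃ h : (Fin (k * 3) → Bool) → Bool, ∃ ℓ : Fin (k * 3) → Bool, ∀ y' y'' : Fin (k * 3) → Bool,
            (if (C 1).eval (e (Fin.append y' y'')) then (1 : ZMod 2) else 0) =
              (∑ i, (if y' i then (1 : ZMod 2) else 0) * (if (fun x : Fin 3 → Bool => (![x 0 ^^ x 1 ^^ x 2 ^^ (x 1 && x 2), (x 0 && x 1) ^^ (x 0 && x 2) ^^ x 1, (x 0 && x 1) ^^ x 2] : Fin 3 → Bool)) (fun s => y'' (finProdFinEquiv ((finProdFinEquiv.symm i).1, s))) (finProdFinEquiv.symm i).2 then (1 : ZMod 2) else 0)) +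
                (if h y'' then (1 : ZMod 2) else 0) + (∑ i, (if y' i then (1 : ZMod 2) else 0) * (if ℓ i then (1 : ZMod 2) else 0))) →
        ∀ S U : Finset (Fin (k * 3 + k * 3) → Bool),
          (zeroVec ∈ S ∧ ∀ x ∈ S, ∀ y ∈ S, bxor x y ∈ S) → (zeroVec ∈ U ∧ ∀ x ∈ U, ∀ y ∈ U, bxor x y ∈ U) →
          ((∀ s ∈ S, ∀ y : Fin (k * 3 + k * 3) → Bool, (fun k => ((C 1).eval zeroVec ^^ (C 1).eval (bxor zeroVec s) ^^ (C 1).eval (bxor zeroVec y) ^^ (C 1).eval (bxor zeroVec (bxor s y))) ^^ ((C 1).eval (fun j => decide (j = k)) ^^ (C 1).eval (bxor (fun j => decide (j = k)) s) ^^ (C 1).eval (bxor (fun j => decide (j = k)) y) ^^ (C 1).eval (bxor (fun j => decide (j = k)) (bxor s y)))) ∈ U) ∧ (∀ s ∈ S, ∃ ℓ ∈ U, ∀ r : Fin (k * 3 + k * 3) → Bool, (∀ y z : Fin (k * 3 + k * 3) → Bool, (((C 1).eval z ^^ (C 1).eval (bxor z s) ^^ (C 1).eval (bxor z r) ^^ (C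 1).eval (bxor z (bxor s r))) ^^ ((C 1).eval (bxor z y) ^^ (C 1).eval (bxor (bxor z y) s) ^^ (C 1).eval (bxor (bxor z y) r) ^^ (C 1).eval (bxor (bxor z y) (bxor s r)))) = false) → ((C 1).eval r ^^ (C 1).eval (bxor r s) ^^ (C 1).eval zeroVec ^^ (C 1).eval s) = ((Finset.univ.filter fun i => ℓ i && r i).card).bodd)) →
          ((∀ s ∈ U, ∀ y : Fin (k * 3 + k * 3) → Bool, (fun k => ((C 0).eval zeroVec ^^ (C 0).eval (bxor zeroVec s) ^^ (C 0).eval (bxor zeroVec y) ^^ (C 0).eval (bxor zeroVec (bxor s y))) ^^ ((C 0).eval (fun j => decide (j = k)) ^^ (C 0).eval (bxor (fun j => decide (j = k)) s) ^^ (C 0).eval (bxor (fun j => decide (j = k)) y) ^^ (C 0).eval (bxor (fun j => decide (j = k)) (bxor s y)))) ∈ S) ∧ (∀ s ∈ U, ∃ ℓ ∈ S, ∀ r : Fin (k * 3 + k * 3) → Bool, (∀ y z : Fin (k * 3 + k * 3) → Bool, (((C 0).eval z ^^ (C 0).eval (bxor z s) ^^ (C 0).eval (bxor z r) ^^ (C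 0).eval (bxor z (bxor s r))) ^^ ((C 0).eval (bxor z y) ^^ (C 0).eval (bxor (bxor z y) s) ^^ (C 0).eval (bxor (bxor z y) r) ^^ (C 0).eval (bxor (bxor z y) (bxor s r)))) = false) → ((C 0).eval r ^^ (C 0).eval (bxor r s) ^^ (C 0).eval zeroVec ^^ (C 0).eval s) = ((Finset.univ.filter fun i => ℓ i && r i).card).bodd)) →
          (∀ s ∈ S, ∀ u ∈ U, ((Finset.univ.filter fun i => s i && u i).card).bodd = false) →
          S.card < 2 ^ (k * 3) → U.card < 2 ^ (k * 3) →
          (¬ ∃ v : Fin (k * 3 + k * 3) → Bool, (∀ x y z : Fin (k * 3 + k * 3) → Bool, (((C 1).eval z ^^ (C 1).eval (bxor z x) ^^ (C 1).eval (bxor z v) ^^ (C 1).eval (bxor z (bxor x v))) ^^ ((C 1).eval (bxor z y) ^^ (C 1).eval (bxor (bxor z y) x) ^^ (C 1).eval (bxor (bxor z y) v) ^^ (C 1).eval (bxor (bxor z y) (bxor x v)))) = false) ∧ (∀ s ∈ S, ∀ x, ((C 1).eval x ^^ (C 1).eval (bxor x s) ^^ (C 1).eval (bxor x v) ^^ (C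 1).eval (bxor x (bxor s v))) = false) ∧ (∀ u ∈ U, ((Finset.univ.filter fun i => u i && v i).card).bodd = false) ∧ v ∉ S) →
          (¬ ∃ v : Fin (k * 3 + k * 3) → Bool, (∀ x y z : Fin (k * 3 + k * 3) → Bool, (((C 0).eval z ^^ (C 0).eval (bxor z x) ^^ (C 0).eval (bxor z v) ^^ (C 0).eval (bxor z (bxor x v))) ^^ ((C 0).eval (bxor z y) ^^ (C 0).eval (bxor (bxor z y) x) ^^ (C 0).eval (bxor (bxor z y) v) ^^ (C 0).eval (bxor (bxor z y) (bxor x v)))) = false) ∧ (∀ s ∈ U, ∀ x, ((C 0).eval x ^^ (C 0).eval (bxor x s) ^^ (C 0).eval (bxor x v) ^^ (C 0).eval (bxor x (bxor s v))) = false) ∧ (∀ u ∈ S, ((Finset.univ.filter fun i => u i && v i).card).bodd = false) ∧ v ∉ U) →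
          (∃ r : ℕ, r ≤ k * 3 + k * 3 + 1 ∧ (2 : ℝ) ^ ((k * 3 + k * 3) * r) / ((k * 3 + k * 3 + 2 : ℝ) ^ 8) ≤ (∑ xs : Fin (r) → (Fin (k * 3 + k * 3) → Bool), (((@Finset.filter (Fin (k * 3 + k * 3) → Bool) (fun v => v ∉ S ∧ (∃ V : Finset (Fin (k * 3 + k * 3) → Bool), ((zeroVec ∈ V ∧ ∀ x ∈ V, ∀ y ∈ V, bxor x y ∈ V) ∧ (((V).card : ℝ) ^ 2 = (2 : ℝ) ^ (k * 3 + k * 3)) ∧ ∀ u ∈ V, ∀ v ∈ V, ∀ x, ((C 1).eval x ^^ (C 1).eval (bxor x u) ^^ (C 1).eval (bxor x v) ^^ (C 1).eval (bxor x (bxor u v))) = false) ∧ S ⊆ V ∧ v ∈ V ∧ (∀ s ∈ V, ∀ u ∈ U, ((Finset.univ.filter fun i => s i && u i).card).bodd = false))) (Classical.decPred _) (Finset.univ.filter fun (v : Fin (k * 3 + k * 3) → Bool) => (∀ s ∈ S, ∀ x, ((C 1).eval x ^^ (C 1).eval (bxor x s) ^^ (C 1).eval (bxor x v) ^^ (C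 1).eval (bxor x (bxor s v))) = false) ∧ (∀ u ∈ U, ((Finset.univ.filter fun i => u i && v i).card).bodd = false) ∧ ∀ j, (∀ y z : Fin (k * 3 + k * 3) → Bool, (((C 1).eval z ^^ (C 1).eval (bxor z (xs j)) ^^ (C 1).eval (bxor z v) ^^ (C 1).eval (bxor z (bxor (xs j) v))) ^^ ((C 1).eval (bxor z y) ^^ (C 1).eval (bxor (bxor z y) (xs j)) ^^ (C 1).eval (bxor (bxor z y) v) ^^ (C 1).eval (bxor (bxor z y) (bxor (xs j) v)))) = false))).card : ℝ) / (((Finset.univ.filter fun (v : Fin (k * 3 + k * 3) → Bool) => (∀ s ∈ S, ∀ x, ((C 1).eval x ^^ (C 1).eval (bxor x s) ^^ (C 1).eval (bxor x v) ^^ (C 1).eval (bxor x (bxor s v))) = false) ∧ (∀ u ∈ U, ((Finset.univ.filter fun i => u i && v i).card).bodd = false) ∧ ∀ j, (∀ y z : Fin (k * 3 + k * 3) → Bool, (((C 1).eval z ^^ (C 1).eval (bxor z (xs j)) ^^ (C 1).eval (bxor z v) ^^ (C 1).eval (bxor z (bxor (xs j) v))) ^^ ((C 1).eval (bxor z y)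 ^^ (C 1).eval (bxor (bxor z y) (xs j)) ^^ (C 1).eval (bxor (bxor z y) v) ^^ (C 1).eval (bxor (bxor z y) (bxor (xs j) v)))) = false))).card : ℝ)))) ∨
          (∃ r : ℕ, r ≤ k * 3 + k * 3 + 1 ∧ (2 : ℝ) ^ ((k * 3 + k * 3) * r) / ((k * 3 + k * 3 + 2 : ℝ) ^ 8) ≤ (∑ xs : Fin (r) → (Fin (k * 3 + k * 3) → Bool), (((@Finset.filter (Fin (k * 3 + k * 3) → Bool) (fun v => v ∉ U ∧ (∃ V : Finset (Fin (k * 3 + k * 3) → Bool), ((zeroVec ∈ V ∧ ∀ x ∈ V, ∀ y ∈ V, bxor x y ∈ V) ∧ (((V).card : ℝ) ^ 2 = (2 : ℝ) ^ (k * 3 + k * 3)) ∧ ∀ u ∈ V, ∀ v ∈ V, ∀ x, ((C 0).eval x ^^ (C 0).eval (bxor x u) ^^ (C 0).eval (bxor x v) ^^ (C 0).eval (bxor x (bxor u v))) = false) ∧ U ⊆ V ∧ v ∈ V ∧ (∀ s ∈ V, ∀ u ∈ S, ((Finset.univ.filter fun i => s i && u i).card).bodd = false))) (Classical.decPred _)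 (Finset.univ.filter fun (v : Fin (k * 3 + k * 3) → Bool) => (∀ s ∈ U, ∀ x, ((C 0).eval x ^^ (C 0).eval (bxor x s) ^^ (C 0).eval (bxor x v) ^^ (C 0).eval (bxor x (bxor s v))) = false) ∧ (∀ u ∈ S, ((Finset.univ.filter fun i => u i && v i).card).bodd = false) ∧ ∀ j, (∀ y z : Fin (k * 3 + k * 3) → Bool, (((C 0).eval z ^^ (C 0).eval (bxor z (xs j)) ^^ (C 0).eval (bxor z v) ^^ (C 0).eval (bxor z (bxor (xs j) v))) ^^ ((C 0).eval (bxor z y) ^^ (C 0).eval (bxor (bxor z y) (xs j)) ^^ (C 0).eval (bxor (bxor z y) v) ^^ (C 0).eval (bxor (bxor z y) (bxor (xs j) v)))) = false))).card : ℝ) / (((Finset.univ.filter fun (v : Fin (k * 3 + k * 3) → Bool) => (∀ s ∈ U, ∀ x, ((C 0).eval x ^^ (C 0).eval (bxor x s) ^^ (C 0).eval (bxor x v) ^^ (C 0).eval (bxor x (bxor s v))) = false) ∧ (∀ u ∈ S, ((Finset.univ.filter fun i => u i && v i).card).bodd = false) ∧ ∀ j, (∀ y z : Fin (k * 3 + k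 * 3) → Bool, (((C 0).eval z ^^ (C 0).eval (bxor z (xs j)) ^^ (C 0).eval (bxor z v) ^^ (C 0).eval (bxor z (bxor (xs j) v))) ^^ ((C 0).eval (bxor z y) ^^ (C 0).eval (bxor (bxor z y) (xs j)) ^^ (C 0).eval (bxor (bxor z y) v) ^^ (C 0).eval (bxor (bxor z y) (bxor (xs j) v)))) = false))).card : ℝ)))) := by
  intro k hk C _hB2 hdeg hΦ horb S U hS hU hcb hca ho hSlt _hUlt _habsB _habsA
  left
  set b : (Fin (k * 3 + k * 3) → Bool) → Bool := (C 1).eval with hbdef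
  set a : (Fin (k * 3 + k * 3) → Bool) → Bool := (C 0).eval with hadef
  have hb : IsDegLeFun 3 b := hdeg 1
  have ha : IsDegLeFun 3 a := hdeg 0
  obtain ⟨e, ⟨M, c, hM⟩, h, ℓ, hbt⟩ := horb
  -- ### Step 1: the affine bijection `e y = L y ⊕ cb`, its inverse, adjoint and inverse adjoint
  obtain ⟨cb, hcbdef⟩ : ∃ cb : Fin (k * 3 + k * 3) → Bool, cb = fun i => decide (c i = 1) := ⟨_, rfl⟩
  obtain ⟨L, hLdef⟩ : ∃ L : (Fin (k * 3 + k * 3) → Bool) → (Fin (k * 3 + k * 3) → Bool), ∀ y, L y = bxor (e y) cb :=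
    ⟨_, fun _ => rfl⟩
  have hcc : ∀ x : Fin (k * 3 + k * 3) → Bool, bxor (bxor x cb) cb = x := fun x => ur_bxor_cancel_right x cb
  have hL : ∀ x y, L (bxor x y) = bxor (L x) (L y) := by
    intro x y
    rw [hLdef, hLdef, hLdef, hcbdef]
    exact additive_linear_part e M c hM x y
  have he : ∀ y, e y = bxor (L y) cb := fun y => by rw [hLdef, hcc]
  obtain ⟨Li, hLidef⟩ : ∃ Li : (Fin (k * 3 + k * 3) → Bool) → (Fin (k * 3 + k * 3) → Bool),
      ∀ x, Li x = e.symm (bxor x cb) := ⟨_, fun _ => rfl⟩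
  have hLLi : ∀ x, L (Li x) = x := fun x => by rw [hLdef, hLidef, Equiv.apply_symm_apply, hcc]
  have hLiL : ∀ y, Li (L y) = y := fun y => by rw [hLidef, hLdef, hcc, Equiv.symm_apply_apply]
  have hLi : ∀ x y, Li (bxor x y) = bxor (Li x) (Li y) := inverse_additive hL hLLi hLiL
  obtain ⟨Lt, hadj⟩ := exists_adjoint L hL
  obtain ⟨Lti, hadji⟩ := exists_adjoint Li hLi
  have hLti : ∀ x y, Lti (bxor x y) = bxor (Lti x) (Lti y) := adjoint_additive hadji
  have h1 : ∀ y, Lt (Lti y) = y := fun y => eq_of_bdot_eq fun x => by rw [← hadj, ← hadji, hLiL]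
  have h2 : ∀ y, Lti (Lt y) = y := fun y => eq_of_bdot_eq fun x => by rw [← hadji, ← hadj, hLLi]
  have hadj' : ∀ x y, (univ.filter fun i => Lti x i && y i).card.bodd =
      (univ.filter fun i => x i && Li y i).card.bodd := fun x y => by
    rw [bdot_comm, ← hadji, bdot_comm]
  -- ### Step 2: the transported pair `b₀ = b ∘ e`, `a₀ = a ∘ L⁻ᵀ ⊕ (L⁻ᵀ ·)·cb`
  obtain ⟨b₀, hb₀⟩ : ∃ b₀ : (Fin (k * 3 + k * 3) → Bool) → Bool, ∀ y, b₀ y = b (e y) := ⟨_, fun _ => rfl⟩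
  obtain ⟨a₀, ha₀⟩ : ∃ a₀ : (Fin (k * 3 + k * 3) → Bool) → Bool,
      ∀ x, a₀ x = (a (Lti x) ^^ (univ.filter fun i => Lti x i && cb i).card.bodd) := ⟨_, fun _ => rfl⟩
  have hb₀' : ∀ y, b₀ y = (b (bxor (L y) cb) ^^ false) := fun y => by rw [hb₀, he, Bool.xor_false]
  have ha₀' : ∀ x, a₀ x = (a (bxor (Lti x) zeroVec) ^^ (univ.filter fun i => Lti x i && cb i).card.bodd) :=
    fun x => by rw [ha₀, bxor_zeroVec]
  have hlam : ∀ x y, (univ.filter fun i => Lti (bxor x y) i && cb i).card.bodd =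
      ((univ.filter fun i => Lti x i && cb i).card.bodd ^^ (univ.filter fun i => Lti y i && cb i).card.bodd) :=
    fun x y => by rw [hLti, bdot_bxor_left]
  have hb₀3 : IsDegLeFun 3 b₀ := by
    have e1 : b₀ = fun y => b (bxor (L y) cb) := funext fun y => by rw [hb₀, he]
    rw [e1]
    exact isDegLeFun_comp_affine hb hL cb
  have ha₀3 : IsDegLeFun 3 a₀ := by
    rw [show a₀ = fun x => (a (bxor (Lti x) zeroVec) ^^ (univ.filter fun i => Lti x i && cb i).card.bodd) from
      funext ha₀']
    exact (knf_isDegLeFun_xor' (isDegLeFun_comp_affine ha hLti zeroVec) (isDegLeFun_one_of_additive hlam)).mono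
      (by norm_num)
  -- the template shape of `b₀` over `permL k ℓ`, exactness, the dual shape of `a₀`
  have hb₀t : ∀ y' y'' : Fin (k * 3) → Bool, b₀ (Fin.append y' y'') =
      (((Finset.univ.filter fun i => y' i && (CubeBS.permL k ℓ y'') i).card.bodd) ^^ h y'') := fun y' y'' => by
    rw [hb₀]
    exact CubeBS.template_bool_lin (g := fun y => b (e y)) hbt y' y''
  have hΦ₀ : forrelation a₀ b₀ = 1 ∨ forrelation a₀ b₀ = -1 := by
    rw [forrelation_transport a b a₀ b₀ e L Lt Lti cb he hadj h1 h2 hb₀ ha₀]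
    exact hΦ
  have ha₀t := stub_dualShape (k * 3) a₀ b₀ (CubeBS.permL k ℓ) h hb₀t hΦ₀
  -- ### Step 3: the transported pair of subspaces `S₀ = L⁻¹ S`, `U₀ = Lᵀ U` and its hypotheses
  have hS₀ := isSub_image hLi hS
  have hA : ∀ s ∈ S.image Li, L s ∈ S := fun s hs => by
    obtain ⟨s', hs', rfl⟩ := mem_image.1 hs
    rw [hLLi]
    exact hs'
  have hA' : ∀ u ∈ U.image Lt, Lti u ∈ U := fun u hu => by
    obtain ⟨u', hu', rfl⟩ := mem_image.1 hu
    rw [h2]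
    exact hu'
  have hclb₀ := closedF_transport b b₀ hb L Lt cb (fun _ => false) hL (fun y => ⟨Li y, hLLi y⟩) hadj
    (fun _ _ => rfl) hb₀' S U (S.image Li) (U.image Lt) hA (fun ℓ hℓ => mem_image_of_mem Lt hℓ) hcb
  have hcla₀ := closedF_transport a a₀ ha Lti Li zeroVec (fun x => (univ.filter fun i => Lti x i && cb i).card.bodd)
    hLti (fun y => ⟨Lt y, h2 y⟩) hadj' hlam ha₀' U S (U.image Lt) (S.image Li) hA'
    (fun ℓ hℓ => mem_image_of_mem Li hℓ) hca
  have ho₀ : ∀ s ∈ S.image Li, ∀ u ∈ U.image Lt, ((Finset.univ.filter fun i => s i && u i).card).bodd = false := by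
    intro s hs u hu
    obtain ⟨s', hs', rfl⟩ := mem_image.1 hs
    obtain ⟨u', hu', rfl⟩ := mem_image.1 hu
    rw [← hadj, hLLi]
    exact ho s' hs' u' hu'
  have hS₀lt : (S.image Li).card < 2 ^ (k * 3) := lt_of_le_of_lt card_image_le hSlt
  -- ### Step 4: the template theorem for `(a₀, b₀)` at `(S₀, U₀)`, transported back to `b` at `(S, U)`
  obtain ⟨r, hr, hbound⟩ := CubeBS.cubeBlockSums_template k hk ℓ a₀ b₀ h _ ha₀3 hb₀3 hb₀t ha₀t (S.image Li)
    (U.image Lt) hS₀ hclb₀ hcla₀ ho₀ hS₀lt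
  have hA₀ : ∀ v, v ∈ S.image Li ↔ L v ∈ S := by
    intro v
    constructor
    · exact hA v
    · intro hv
      exact mem_image.2 ⟨L v, hv, hLiL v⟩
  have hB₁ : ∀ u ∈ U, Lt u ∈ U.image Lt := fun u hu => mem_image_of_mem Lt hu
  have hB₂ : ∀ u ∈ U.image Lt, ∃ u' ∈ U, Lt u' = u := fun u hu => by
    obtain ⟨u', hu', rfl⟩ := mem_image.1 hu
    exact ⟨u', hu', rfl⟩
  have htr := goodMass_transport b b₀ L Li Lt cb (fun _ => false) hL hLLi hLiL hadj (fun _ _ => rfl) hb₀' S U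
    (S.image Li) (U.image Lt) hA₀ hB₁ hB₂ r
  exact ⟨r, hr, hbound.trans_eq htr⟩

end Summit.QuantumAdvantage.QuantumAdvantage.Theorems.SignedExactCubicForrelationNotPrBPP
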